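import Literature.NumberTheory.LFunctions.ClassGroupCharacterEulerProduct
import Literature.NumberTheory.LFunctions.UniformClassGroupPNTInputs
import Literature.NumberTheory.LFunctions.ClassGroupLFunctionEntire
import Literature.NumberTheory.LFunctions.DedekindZetaEntireConvexity
import Literature.NumberTheory.GaloisRepresentations.FrobeniusDensityTheorem
import HarnessLib

/-!
# `ζ_E = ζ_K · L(s, χ)` for the quadratic class field `E/K` of a real class group character `χ`

Topic `Literature/NumberTheory/LFunctions`, namespace `Literature.NumberTheory.LFunctions.NumberField`.
Theorem-only file (no definition, no named fact).

Let `E/K` be a Galois extension of number fields of degree `2`, unramified at every finite prime, and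
`χ : Cl(𝓞 K) → ℂˣ` a real class group character (`χ² = 1`) with the SPLITTING LAW: a prime `v` of
`K` splits completely in `E` iff `χ([v]) = 1` (this is what the tree's class field theory attaches to
`χ ≠ 1` real: `exists_classField_char_frobenius`, `mem_splitPrimes_iff_eq_one_of_classField`,
`finrank_eq_card_range_of_classField`).  Then

* `prod_primesOver_eulerFactor_eq_mul` — above each prime `v` of `K`:
  `∏_{w ∣ v} (1 − Nw^{-s})⁻¹ = (1 − Nv^{-s})⁻¹ (1 − χ([v]) Nv^{-s})⁻¹` (`v` split: two primes of norm
  `Nv`; `v` inert: one prime of norm `Nv²`, `(1 − T²) = (1 − T)(1 + T)`);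
* `dedekindZeta_eq_mul_classGroupLFunction` — **`ζ_E(s) = ζ_K(s) · L(s, χ)` for `Re s > 1`**
  (Euler products, regrouped along `w ↦ w ∩ 𝓞 K`, Mathlib `HasProd.sigma`);
* `dedekindZeta₁_eq_mul_classGroupLFunction₀` — the entire versions agree on all of `ℂ`:
  `ζ₁_E = ζ₁_K · L₀(·, χ)` (`χ ≠ 1`; identity theorem);
* `dedekindZetaCont_eq_zero_of_classGroupLFunction_eq_zero` — hence **every zero `σ < 1` (real) of
  `L(s, χ)` is a zero of `ζ_E`** — the input for Stark's theorem on the field `E`.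

This is Artin's factorisation `ζ_E = ∏_{χ ∈ Gal(E/K)^} L(s, χ)` (Neukirch VII (10.4)–(10.6)) for a
quadratic unramified `E/K`, written with the tree's Hecke `L`-function `classGroupLFunction` of the
class group character through the splitting law, so that no Artin formalism is needed downstream.

## References

* J. Neukirch, *Algebraic Number Theory* (1999), Ch. VII (8.1) (Euler products), (10.4)–(10.6)
  (`ζ_E` as a product of `L`-series), Ch. I (8.2) (fundamental identity). [NeukirchANT1999]
* D. A. Cox, *Primes of the form x² + ny²*, 2nd ed. (2013), §5.C Cor. 5.24, §8.A Thm. 8.10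
  (class fields of subgroups of the class group, splitting law). [Cox2013]
-/

noncomputable section

open scoped NumberField nonZeroDivisors
open Complex NumberField IsDedekindDomain Filter Topology

namespace Literature.NumberTheory.LFunctions.NumberField

open Literature.NumberTheory.GaloisRepresentations

section LocalFactor

variable {K : Type*} [Field K] [NumberField K] {E : Type*} [Field E] [NumberField E] [Algebra K E]
  [IsGalois K E]

/-- **Split case**: if `v` splits completely in the quadratic `E/K`, the two primes above `v` have
norm `Nv`, so `∏_{w ∣ v} f(Nw) = f(Nv)²`. [folklore] -/
theorem prod_primesOver_eq_sq_of_mem_splitPrimes (h2 : Module.finrank K E = 2)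
    {v : HeightOneSpectrum (𝓞 K)} (hv : v ∈ splitPrimes K E) (f : ℕ → ℂ) :
    ∏ Q : v.asIdeal.primesOver (𝓞 E), f (Ideal.absNorm Q.1) = f (Ideal.absNorm v.asIdeal) ^ 2 := by
  have hconst : ∀ Q : v.asIdeal.primesOver (𝓞 E), f (Ideal.absNorm Q.1) = f (Ideal.absNorm v.asIdeal) :=
    fun Q => by rw [absNorm_eq_of_mem_splitPrimes hv Q.2]
  rw [Finset.prod_congr rfl fun Q _ => hconst Q, Finset.prod_const, Finset.card_univ,
    ← Nat.card_eq_fintype_card, Nat.card_coe_set_eq, ncard_primesOver_of_mem_splitPrimes hv, h2]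

/-- **Inert case**: if `v` is unramified but does not split completely in the quadratic `E/K`, there
is exactly one prime above `v`, of norm `Nv²`, so `∏_{w ∣ v} f(Nw) = f(Nv²)`. [folklore] -/
theorem prod_primesOver_eq_of_not_mem_splitPrimes (h2 : Module.finrank K E = 2)
    {v : HeightOneSpectrum (𝓞 K)} (hunr : Algebra.IsUnramifiedIn (𝓞 E) v.asIdeal)
    (hv : v ∉ splitPrimes K E) (f : ℕ → ℂ) :
    ∏ Q : v.asIdeal.primesOver (𝓞 E), f (Ideal.absNorm Q.1) = f (Ideal.absNorm v.asIdeal ^ 2) := by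
  classical
  haveI : IsGaloisGroup (E ≃ₐ[K] E) (𝓞 K) (𝓞 E) := IsGaloisGroup.of_isFractionRing _ _ _ K E
  haveI := v.isPrime
  haveI := v.isMaximal
  -- a prime `Q₀ ∣ v` with residue degree `≠ 1`
  have hex : ∃ Q ∈ v.asIdeal.primesOver (𝓞 E), Q.inertiaDeg (𝓞 K) ≠ 1 := by
    by_contra h
    push Not at h
    exact hv ⟨hunr, h⟩
  obtain ⟨Q₀, hQ₀, hf₀⟩ := hex
  haveI := hQ₀.1
  haveI := hQ₀.2
  -- fundamental identity: `g · e · f = 2`, `e = 1`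
  have hid := Ideal.ncard_primesOver_mul_ramificationIdxIn_mul_inertiaDegIn v.asIdeal (𝓞 E) (E ≃ₐ[K] E)
  have hQ₀max : Q₀.IsMaximal := hQ₀.1.isMaximal (Ideal.ne_bot_of_mem_primesOver v.ne_bot hQ₀)
  have he : Q₀.ramificationIdx (𝓞 K) = 1 :=
    Ideal.ramificationIdx_eq_one_iff.mpr (hunr Q₀ hQ₀.1 hQ₀.2)
  rw [Ideal.ramificationIdxIn_eq_ramificationIdx v.asIdeal Q₀ (E ≃ₐ[K] E),
    Ideal.inertiaDegIn_eq_inertiaDeg v.asIdeal Q₀ (E ≃ₐ[K] E), he, one_mul,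
    IsGalois.card_aut_eq_finrank, h2] at hid
  -- so `f(Q₀) = 2` and `Q₀` is the only prime above `v`
  have hfdvd : Q₀.inertiaDeg (𝓞 K) ∣ 2 := Dvd.intro_left _ hid
  have hf2 : Q₀.inertiaDeg (𝓞 K) = 2 := by
    rcases (Nat.dvd_prime Nat.prime_two).mp hfdvd with h | h
    · exact absurd h hf₀
    · exact h
  rw [hf2] at hid
  have hcard : (v.asIdeal.primesOver (𝓞 E)).ncard = 1 := by omega
  have hcard' : Fintype.card (v.asIdeal.primesOver (𝓞 E)) = 1 := by
    rw [← Nat.card_eq_fintype_card, Nat.card_coe_set_eq, hcard]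
  obtain ⟨Q₁, hQ₁⟩ := Fintype.card_eq_one_iff.mp hcard'
  have huniv : (Finset.univ : Finset (v.asIdeal.primesOver (𝓞 E))) = {⟨Q₀, hQ₀⟩} := by
    ext Q; simp [hQ₁ Q, hQ₁ ⟨Q₀, hQ₀⟩]
  rw [huniv, Finset.prod_singleton]
  -- norm of `Q₀`
  congr 1
  rw [← Ideal.absNorm_pow_inertiaDeg v.asIdeal Q₀, hf2]

end LocalFactor

section EulerProduct

variable {K : Type*} [Field K] [NumberField K] {E : Type*} [Field E] [NumberField E] [Algebra K E]
  [IsGalois K E]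

/-- **The Euler factor of `ζ_E` above `v` for the quadratic class field of a real character**:
if `[E:K] = 2`, `v` is unramified in `E`, `χ² = 1` and `v` splits completely in `E` iff `χ([v]) = 1`,
then `∏_{Q ∣ v} (1 − NQ^{-s})⁻¹ = (1 − Nv^{-s})⁻¹ · (1 − χ([v]) Nv^{-s})⁻¹` (product over the primes of
`𝓞 E` above `v`).
[cite: NeukirchANT1999, Ch. VII (10.4)–(10.6)] -/
theorem prod_primesOver_eulerFactor_eq_mul (h2 : Module.finrank K E = 2)
    (χ : ClassGroup (𝓞 K) →* ℂˣ) (hχ : χ * χ = 1) (v : HeightOneSpectrum (𝓞 K))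
    (hunr : Algebra.IsUnramifiedIn (𝓞 E) v.asIdeal)
    (hsplit : v ∈ splitPrimes K E ↔ classGroupCharPrimeValue χ v = 1) (s : ℂ) :
    ∏ Q : v.asIdeal.primesOver (𝓞 E), (1 - ((Ideal.absNorm Q.1 : ℕ) : ℂ) ^ (-s))⁻¹ =
      dedekindEulerFactor K v s *
        (1 - classGroupCharPrimeValue χ v * ((Ideal.absNorm v.asIdeal : ℕ) : ℂ) ^ (-s))⁻¹ := by
  set f : ℕ → ℂ := fun n => (1 - (n : ℂ) ^ (-s))⁻¹ with hf
  change ∏ Q : v.asIdeal.primesOver (𝓞 E), f (Ideal.absNorm Q.1) = _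
  rcases classGroupChar_apply_eq_one_or_eq_neg_one hχ
    (ClassGroup.mk0 ⟨v.asIdeal, mem_nonZeroDivisors_of_ne_zero v.ne_bot⟩) with h1 | h1
  · -- split: two primes of norm `Nv`
    have hv : v ∈ splitPrimes K E := hsplit.mpr h1
    rw [prod_primesOver_eq_sq_of_mem_splitPrimes h2 hv f, classGroupCharPrimeValue_apply, h1, one_mul,
      dedekindEulerFactor, sq]
  · -- inert: one prime of norm `Nv²`
    have hne : classGroupCharPrimeValue χ v ≠ 1 := by
      rw [classGroupCharPrimeValue_apply, h1]; norm_num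
    have hv : v ∉ splitPrimes K E := fun h => hne (hsplit.mp h)
    rw [prod_primesOver_eq_of_not_mem_splitPrimes h2 hunr hv f, classGroupCharPrimeValue_apply, h1,
      dedekindEulerFactor, hf]
    simp only
    set T : ℂ := ((Ideal.absNorm v.asIdeal : ℕ) : ℂ) ^ (-s) with hT
    have hsq : (((Ideal.absNorm v.asIdeal ^ 2 : ℕ) : ℂ)) ^ (-s) = T * T := by
      rw [sq, Nat.cast_mul, natCast_mul_natCast_cpow]
    rw [hsq, ← mul_inv]
    congr 1
    ring

variable (E) in
/-- **`ζ_E(s) = ζ_K(s) · L(s, χ)` for `Re s > 1`**, for the quadratic class field `E/K` of the real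
class group character `χ` (`[E:K] = 2`, `E/K` unramified at all finite primes, splitting law
`v` splits ⟺ `χ([v]) = 1`): both sides are convergent Euler products over the primes of `K`
(`hasProd_dedekindEulerFactor_holds`, regrouped along `w ↦ w ∩ 𝓞 K` by `HasProd.sigma`;
`hasProd_classGroupLFunction`) with the same factors (`prod_primesOver_eulerFactor_eq_mul`).
[cite: NeukirchANT1999, Ch. VII (8.1) and (10.4)–(10.6)] -/
theorem dedekindZeta_eq_mul_classGroupLFunction (h2 : Module.finrank K E = 2)
    (hunr : ∀ v : HeightOneSpectrum (𝓞 K), Algebra.IsUnramifiedIn (𝓞 E) v.asIdeal)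
    (χ : ClassGroup (𝓞 K) →* ℂˣ) (hχ : χ * χ = 1)
    (hsplit : ∀ v : HeightOneSpectrum (𝓞 K), v ∈ splitPrimes K E ↔ classGroupCharPrimeValue χ v = 1)
    {s : ℂ} (hs : 1 < s.re) :
    _root_.NumberField.dedekindZeta E s =
      _root_.NumberField.dedekindZeta K s * classGroupLFunction K χ s := by
  classical
  -- the fibres of `w ↦ w ∩ 𝓞 K` are the (finite) sets of primes above `v`
  let e : ∀ v : HeightOneSpectrum (𝓞 K),
      {w : HeightOneSpectrum (𝓞 E) // w.under (𝓞 K) = v} ≃ v.asIdeal.primesOver (𝓞 E) := fun v =>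
    { toFun := fun w => ⟨w.1.asIdeal, w.1.isPrime, ⟨by
        have h := congrArg HeightOneSpectrum.asIdeal w.2
        rw [HeightOneSpectrum.under_asIdeal] at h
        exact h.symm⟩⟩
      invFun := fun Q => ⟨⟨Q.1, Q.2.1, Ideal.ne_bot_of_mem_primesOver v.ne_bot Q.2⟩,
        HeightOneSpectrum.ext Q.2.2.over.symm⟩
      left_inv := fun w => rfl
      right_inv := fun Q => rfl }
  haveI hfin : ∀ v : HeightOneSpectrum (𝓞 K),
      Fintype {w : HeightOneSpectrum (𝓞 E) // w.under (𝓞 K) = v} := fun v =>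
    Fintype.ofEquiv _ (e v).symm
  -- `ζ_E` regrouped along `w ↦ w ∩ 𝓞 K`
  have hE := hasProd_dedekindEulerFactor_holds E hs
  have hE' := (Equiv.hasProd_iff (Equiv.sigmaFiberEquiv
    (fun w : HeightOneSpectrum (𝓞 E) => w.under (𝓞 K)))).mpr hE
  have hE'' : HasProd (fun v : HeightOneSpectrum (𝓞 K) =>
      ∏ w : {w : HeightOneSpectrum (𝓞 E) // w.under (𝓞 K) = v}, dedekindEulerFactor E w.1 s)
      (_root_.NumberField.dedekindZeta E s) := by
    refine hE'.sigma fun v => ?_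
    simpa only [Function.comp_def, Equiv.sigmaFiberEquiv_apply] using
      hasProd_fintype (fun w : {w : HeightOneSpectrum (𝓞 E) // w.under (𝓞 K) = v} =>
        dedekindEulerFactor E w.1 s)
  -- `ζ_K · L(s, χ)`
  have hKL := (hasProd_dedekindEulerFactor_holds K hs).mul (hasProd_classGroupLFunction K χ hs)
  have heq : (fun v : HeightOneSpectrum (𝓞 K) =>
      ∏ w : {w : HeightOneSpectrum (𝓞 E) // w.under (𝓞 K) = v}, dedekindEulerFactor E w.1 s) =
      fun v => dedekindEulerFactor K v s *
        (1 - classGroupCharPrimeValue χ v * ((Ideal.absNorm v.asIdeal : ℕ) : ℂ) ^ (-s))⁻¹ :=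
    funext fun v => by
      rw [← prod_primesOver_eulerFactor_eq_mul h2 χ hχ v (hunr v) (hsplit v) s]
      exact Fintype.prod_equiv (e v) _ _ fun w => rfl
  rw [heq] at hE''
  exact hE''.unique hKL

variable (E) in
/-- **The entire versions agree everywhere**: `ζ₁_E(s) = ζ₁_K(s) · L₀(s, χ)` for ALL `s ∈ ℂ`
(`ζ₁ = (s−1)ζ`, `L₀` the entire `L`-function of `χ ≠ 1`), by the identity theorem from `Re s > 1`.
[cite: NeukirchANT1999, Ch. VII (10.4)–(10.6)] -/
theorem dedekindZeta₁_eq_mul_classGroupLFunction₀ (h2 : Module.finrank K E = 2)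
    (hunr : ∀ v : HeightOneSpectrum (𝓞 K), Algebra.IsUnramifiedIn (𝓞 E) v.asIdeal)
    (χ : ClassGroup (𝓞 K) →* ℂˣ) (hχ : χ * χ = 1) (hχ1 : χ ≠ 1)
    (hsplit : ∀ v : HeightOneSpectrum (𝓞 K), v ∈ splitPrimes K E ↔ classGroupCharPrimeValue χ v = 1)
    (s : ℂ) : dedekindZeta₁ E s = dedekindZeta₁ K s * classGroupLFunction₀ K χ s := by
  set F : ℂ → ℂ := dedekindZeta₁ E with hF
  set G : ℂ → ℂ := fun z => dedekindZeta₁ K z * classGroupLFunction₀ K χ z with hG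
  have hFa : AnalyticOnNhd ℂ F Set.univ := analyticOnNhd_dedekindZeta₁ E Set.univ
  have hGd : Differentiable ℂ G :=
    (dedekindZeta₁_differentiable K).mul (differentiable_classGroupLFunction₀ χ)
  have hGa : AnalyticOnNhd ℂ G Set.univ := fun z _ => hGd.analyticAt z
  have h2re : (2 : ℂ) ∈ Set.univ := Set.mem_univ _
  have heq : F =ᶠ[𝓝 (2 : ℂ)] G := by
    have hopen : IsOpen {z : ℂ | 1 < z.re} := continuous_re.isOpen_preimage _ isOpen_Ioi
    refine eventually_of_mem (hopen.mem_nhds (by simp : 1 < (2 : ℂ).re)) fun z (hz : 1 < z.re) => ?_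
    have hz1 : z ≠ 1 := fun h => by rw [h, one_re] at hz; exact lt_irrefl _ hz
    rw [hG]
    simp only
    rw [hF, dedekindZeta₁_apply_eq_mul hz, dedekindZeta₁_apply_eq_mul hz, classGroupLFunction₀_eq χ hz1 hχ1,
      dedekindZeta_eq_mul_classGroupLFunction E h2 hunr χ hχ hsplit hz, mul_assoc]
  have := hFa.eqOn_of_preconnected_of_eventuallyEq hGa isPreconnected_univ h2re heq
  exact this (Set.mem_univ s)

variable (E) in
/-- **Every real zero `σ < 1` of `L(s, χ)` is a zero of `ζ_E`** for the quadratic class field `E`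
of the real character `χ ≠ 1`: `ζ_E(σ) = ζ_K(σ) L(σ, χ) = 0` (the tree's continuation
`dedekindZetaCont`). [cite: NeukirchANT1999, Ch. VII (10.4)–(10.6)] -/
theorem dedekindZetaCont_eq_zero_of_classGroupLFunction_eq_zero (h2 : Module.finrank K E = 2)
    (hunr : ∀ v : HeightOneSpectrum (𝓞 K), Algebra.IsUnramifiedIn (𝓞 E) v.asIdeal)
    (χ : ClassGroup (𝓞 K) →* ℂˣ) (hχ : χ * χ = 1) (hχ1 : χ ≠ 1)
    (hsplit : ∀ v : HeightOneSpectrum (𝓞 K), v ∈ splitPrimes K E ↔ classGroupCharPrimeValue χ v = 1)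
    {s : ℂ} (hs : s ≠ 1) (h0 : classGroupLFunction K χ s = 0) : dedekindZetaCont E s = 0 := by
  have h := dedekindZeta₁_eq_mul_classGroupLFunction₀ E h2 hunr χ hχ hχ1 hsplit s
  rw [classGroupLFunction₀_eq χ hs hχ1, h0, mul_zero] at h
  exact (dedekindZetaCont_eq_zero_of_dedekindZeta₁_eq_zero h).2

end EulerProduct

end Literature.NumberTheory.LFunctions.NumberField

end
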